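import Summits.Langlands.Langlands.Theses.TrigonalHeartLimit
import Summits.Langlands.Langlands.Theorems.PhantomRMYoshidaSerreKWAutomorphicGL2

/-!
# Birth skeleton (BC3) for piece `SerreKWAutomorphicGL2` of the split of
# `TrigonalHeartLimit.OddResidualAutomorphyAtThree` (crux item stmt-Langlands-13672)

This piece is, character for character, the vetted crux item stmt-Langlands-12944 of route
PhantomRMYoshida, which is PROVED IN THE TREE MODULO ONE NAMED FACT:
`Summit.Langlands.Langlands.Cruxes.SerreKWAutomorphicGL2.AdelicNewformDatumDoubleTwist.SerreKWAutomorphicGL2_of_khareWintenberger`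
(Theorems/PhantomRMYoshidaSerreKWAutomorphicGL2.lean, proposal p87561, commit 00844f18724d; its six
other stubs — residue-adapted embedding, conjugate newform, lowering kills lift, adelic lift is a
cusp form, arch parameter of the generated datum, L-dictionary — are LANDED, p80281–p87174).  Hence
the honest skeleton has exactly ONE open stub, the T0 named fact `khare_wintenberger`
(Khare–Wintenberger I, Invent. Math. 178 (2009), Thm. 1.2 + Thm. 9.1, with Kisin 2009); the
composition below is the landed theorem, accepted by definitional unfolding of the two
identical statements.  Registered line of that crux: Cruxes/SerreKWAutomorphicGL2/Lines/
adelic-newform-datum-double-twist.lean (+ .md, PICKED.md, NOTES.md).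
-/

noncomputable section

set_option linter.dupNamespace false

namespace Summit.Langlands.Langlands.Cruxes.OddResidualAutomorphyAtThree.BirthSerreKWAutomorphicGL2

open scoped BigOperators Topology Classical Matrix
open Filter Set Function

/-- the piece, structurally (identical text to `PhantomRMYoshida.SerreKWAutomorphicGL2`). -/
def SerreKWAutomorphicGL2 : Prop :=
  ∀ (p : ℕ) [Fact p.Prime] (k : Type) [Field k] [CharP k p] [IsAlgClosed k] [TopologicalSpace k] [DiscreteTopology k] (red : Valued.integer (PadicAlgCl p) →+* k) (σ : Literature.NumberTheory.GaloisRepresentations.FramedGaloisRep ℚ k 2), σ.IsOdd → σ.toGaloisRep.IsIrreducible → ∀ (hcpt₂ : Literature.NumberTheory.Automorphic.isCompact_glFiniteIntegralLevel 2 ℚ) (ι : PadicAlgCl p ≃+* ℂ), ∃ π₂ : Literature.NumberTheory.Automorphic.CuspidalAutomorphicRepData 2 ℚ hcpt₂, π₂.1.IsLAlgebraic ∧ ∀ᶠ v : IsDedekindDomain.HeightOneSpectrum (NumberField.RingOfIntegers ℚ) in Filter.cofinite, ∃ (a : Multiset ℂ) (P : Polynomial (Valued.integer (PadicAlgCl p)))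 (Pb : Polynomial k), π₂.1.HasSatakeParamAt v a ∧ P.map (Valued.integer (PadicAlgCl p)).subtype = Literature.NumberTheory.Automorphic.arithFrobPolyOfSatake ι v.residueCard 1 a ∧ σ.IsUnramifiedAt v ∧ σ.HasFrobCharpolyAt v Pb ∧ P.map red = Pb

/-- Stub (XL apex, T0 named fact): **Khare–Wintenberger** — Serre's modularity conjecture, strong
form with Serre's weight and level, for every prime `p` (Khare–Wintenberger I Thm. 1.2 + 9.1,
Kisin's 2-adic lifting).  In the tree: `Literature.NumberTheory.Automorphic.khare_wintenberger`.
[cite: KhareWintenberger2009, Thm. 1.2 and Thm. 9.1] [cite: Kisin2009TwoAdic, Thm. 0.1] -/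
theorem stub_khareWintenberger :
    ∀ (p : ℕ) [Fact p.Prime] (k : Type) [Field k] [TopologicalSpace k] [DiscreteTopology k],
      Literature.NumberTheory.Automorphic.khare_wintenberger p k := by
  sorry

/-- **Composition** (kernel-checked; no `sorry` outside the one stub): the LANDED conditional
theorem of the sibling line applied to the stub — accepted by definitional unfolding of the two
character-identical statements. -/
theorem SerreKWAutomorphicGL2_of : SerreKWAutomorphicGL2 :=
  Summit.Langlands.Langlands.Cruxes.SerreKWAutomorphicGL2.AdelicNewformDatumDoubleTwist.SerreKWAutomorphicGL2_of_khareWintenberger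
    stub_khareWintenberger

end Summit.Langlands.Langlands.Cruxes.OddResidualAutomorphyAtThree.BirthSerreKWAutomorphicGL2
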